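import Mathlib
import HarnessLib

/-!
# Crux `NoZenoR` (stmt-ResolutionOfSingularities-19943), CONJ C1 of KERNEL-g22 (half): the stable annihilator of a
# birational over-ring lies in the conductor

Route `ResolutionOfSingularities/HomologicalConductor`, chain W4.4 (lead g23). `[OURS]` — AI-formalised, weaker than
expert review; NOT a statement of any manuscript under review. Folklore commutative algebra, recorded because it is
one half of KERNEL-g22's CONJECTURE C1 («ca(R) = conductor for one-dimensional analytically unramified local rings»):
the cohomology annihilator lies in the stable annihilator `𝔰(ΩⁿM)` of every high syzygy, and whenever such a syzygy is
(a sum of copies of) the normalisation `R̄`, the lemma below gives `𝔰 ⊆ 𝔠 = (R : R̄)`.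

Setting: `R` a domain with fraction field `K`, `V` an intermediate ring (`R ⊆ V ⊆ K`, an `R`-subalgebra of `K`).
* `algebraMap_dual_apply` — every `R`-linear `f : V → R` is multiplication by `f 1`: `f v = v · f 1` in `K`
  (write `v = a/b`; then `b·f v = f(b v) = f(a·1) = a·f 1`).
* `dual_apply_one_mul_mem_range` — hence `f 1` conducts `V` into `R`: `f(1)·w ∈ R` for all `w ∈ V`.
* `exists_algebraMap_eq_mul_of_smul_eq_sum` — **if `s·𝟙_V` factors through a finite free `R`-module**, i.e.
  `s·v = Σᵢ fᵢ(v)·bᵢ` for `R`-linear `fᵢ : V → R` and `bᵢ ∈ V`, **then `s` lies in the conductor**: `s·v ∈ R` for every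
  `v ∈ V` (indeed `s = Σ fᵢ(1) bᵢ` and each `fᵢ(1)` conducts).
No new definitions (the conductor is spelled out as `∃ r, algebraMap R K r = algebraMap R K s * v`).
-/

namespace Summit.ResolutionOfSingularities.ResolutionOfSingularities.Theorems.NoZeno.StableAnnConductor

-- single-problem summit: the doubled namespace component is forced
set_option linter.dupNamespace false

universe u v

variable {R : Type u} [CommRing R] [IsDomain R] {K : Type v} [Field K] [Algebra R K] [IsFractionRing R K]
variable (V : Subalgebra R K)

/-- An `R`-linear functional on an intermediate ring `R ⊆ V ⊆ Frac R` is multiplication by its value at `1`: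
`f v = v · f 1` (in `K`). [folklore] -/
theorem algebraMap_dual_apply (f : V →ₗ[R] R) (v : V) :
    algebraMap R K (f v) = (v : K) * algebraMap R K (f 1) := by
  obtain ⟨a, b, hb, hab⟩ := IsFractionRing.div_surjective (A := R) (v : K)
  have hb0 : (b : R) ≠ 0 := nonZeroDivisors.ne_zero hb
  have hbK : algebraMap R K b ≠ 0 :=
    fun h => hb0 ((IsFractionRing.injective R K) (by rw [h, map_zero]))
  -- `b • v = a • 1` in `V`
  have hbv : (b : R) • v = a • (1 : V) := by
    apply Subtype.ext
    change (b : R) • (v : K) = a • ((1 : V) : K)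
    rw [Algebra.smul_def, Algebra.smul_def, OneMemClass.coe_one, mul_one, ← hab]
    field_simp
  have key : (b : R) * f v = a * f 1 := by
    rw [← smul_eq_mul, ← smul_eq_mul, ← map_smul, ← map_smul, hbv]
  have keyK : algebraMap R K b * algebraMap R K (f v) = algebraMap R K a * algebraMap R K (f 1) := by
    rw [← map_mul, ← map_mul, key]
  -- divide by `b`
  have hv : (v : K) = algebraMap R K a / algebraMap R K b := hab.symm
  rw [hv]
  field_simp
  linear_combination keyK

/-- The value at `1` of an `R`-linear functional `V → R` conducts `V` into `R`: `f(1)·w = f(w) ∈ R`. [folklore] -/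
theorem dual_apply_one_mul_mem_range (f : V →ₗ[R] R) (w : V) :
    algebraMap R K (f 1) * (w : K) = algebraMap R K (f w) := by
  rw [algebraMap_dual_apply V f w, mul_comm]

/-- **Stable annihilator ⊆ conductor.** If the homothety `s·𝟙_V` of an intermediate ring `R ⊆ V ⊆ Frac R` factors
through a finite free `R`-module — `s·v = Σᵢ fᵢ(v)·bᵢ` with `fᵢ : V → R` linear and `bᵢ ∈ V` — then `s` conducts `V`
into `R`: for every `v ∈ V` there is `r ∈ R` with `r = s·v` in `K`. (`s = Σ fᵢ(1) bᵢ`, and each `fᵢ(1)` conducts.)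
[OURS · W4.4 · half of KERNEL-g22 CONJ C1] -/
theorem exists_algebraMap_eq_mul_of_smul_eq_sum {s : R} {n : ℕ} (f : Fin n → (V →ₗ[R] R)) (b : Fin n → V)
    (h : ∀ v : V, s • v = ∑ i, f i v • b i) (v : V) :
    ∃ r : R, algebraMap R K r = algebraMap R K s * (v : K) := by
  refine ⟨∑ i, f i (b i * v), ?_⟩
  -- `s = Σ fᵢ(1) bᵢ` in `K`
  have h1 : algebraMap R K s = ∑ i, algebraMap R K (f i 1) * (b i : K) := by
    have := congrArg (fun x : V => (x : K)) (h 1)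
    rw [show ((s • (1 : V) : V) : K) = algebraMap R K s by
          rw [SetLike.val_smul, OneMemClass.coe_one, Algebra.smul_def, mul_one]] at this
    rw [this]
    rw [AddSubmonoidClass.coe_finsetSum]
    refine Finset.sum_congr rfl fun i _ => ?_
    rw [SetLike.val_smul, Algebra.smul_def]
  rw [h1, Finset.sum_mul, map_sum]
  refine Finset.sum_congr rfl fun i _ => ?_
  rw [← dual_apply_one_mul_mem_range V (f i) (b i * v), Subalgebra.coe_mul, mul_assoc]

end Summit.ResolutionOfSingularities.ResolutionOfSingularities.Theorems.NoZeno.StableAnnConductor
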